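import Summits.CriticalPhenomena.PercolationContinuityZ3.Theorems.Transplant.PlanarSkeletonFrmFromProxies
import Summits.CriticalPhenomena.PercolationContinuityZ3.Theorems.Transplant.SkelFrmFrom1ChoiceLTK
import HarnessLib

/-!
# GEN DEF-ROW (RULING D-Us, lead g21 V147b / Us-R1 lead g22; WAVE-Us-MANIFEST v1.0 §3/§9, closure spine levels 3–6) «SkelFrmFrom1ChoiceDefsPx» — the GENERALISED twins of
# the choice-FUNCTION level of «SkelFrmFrom1ChoiceDefs» / «…ChoiceLTK»: **`PlanarSkeletonFrmFrom.ChoiceFnNQPx`** (a choice function over every skeleton WITH PROXIES at a base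
# type — binder `(h1 : Φ.types = {t}) ↦ (D : ℕ) (hP : Φ.HasProxies t D)`) and the FOUR column obligations the U_s node reads by name: `GeomHoldsNQFnPx`,
# `RootHoldsNQWFnLKPx`, `FaceHoldsRNQFnLTKPx`, `ReachHoldsRHNQFnLKPx`

builds on p205010 (kernel theorem, internal audit signed; external expert review pending) — nothing in this file uses p205010.  FIVE definitions (review-queued by D-0009): the
`Type 1` of GEN choice functions and four `Prop`s; no theorem, no node / statement / `@[conjecture]`; NOTHING about the OPEN nodes U (`SamePDropOfSkeletonFrmFrom₁`) / U_s
(`SamePDropOfSkeletonFrmScaled₁`) is claimed.  Lane `prim-bschramm`, seat `prim-bschramm-gen-1` g0 (GEN pen, p3-lineage brief); helper file (`--supports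
stmt-CriticalPhenomena-4575 --as helper`).  GEN hunk class 'h1 ↦ proxy package' (WAVE-Us-MANIFEST §2 (i)) and NOTHING else: the texts are «SkelFrmFrom1ChoiceDefs»'s
`ChoiceFnNQ` / `GeomHoldsNQFn` and «SkelFrmFrom1ChoiceLTK»'s `RootHoldsNQWFnLK` / `FaceHoldsRNQFnLTK` / `ReachHoldsRHNQFnLK` with the one-type binder `Φ.types = {t}`
replaced by `(D : ℕ)`, `Φ.HasProxies t D` (Us-0 «PlanarSkeletonFrmFromProxies»).  ROW MAPPING (Us-R1): this ONE def file carries the Fn-level DEF content of the manifest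
rows «…ChoiceDefsPx», «…ChoiceLPx», «…ChoiceLTPx», «…ChoiceLTKPx»; the floor-free Fn-Props `RootHoldsNQWFnL` / `FaceHoldsRNQFnL(T)` / `ReachHoldsRHNQFnL` get NO twin
(no consumer below the U_s node — the column tops conclude the K-floor Props, as U's do); the GEN closure top is the proof file «SkelFrmFrom1ChoiceLTKPx».
The DATA level is untouched and REUSED verbatim: `ChoiceNQ κ Φ t p hC` (the choices at one skeleton), `ChoiceNQ.AtQNQ` (the premises at `q`), `ChoiceNQ.GeomHoldsNQ`,
`ChoiceNQ.RootHoldsNQW` are `h1`-free (GEN-H1-CENSUS: «SkelFrm1ChoiceDefs» binds `h1` nowhere, mentions it only in the two Fn-level Props) — a GEN choice function returns the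
SAME structure, so every 𝒞-level definition and lemma of the U wave (`FaceHoldsRNQ`, `ReachHoldsRHNQL`, …) applies to `𝒞₀ κ G Φ hg t ht D hP p hp0 hp1 hC` as it stands.  U (one type) is the instance `D = 0`,
`hP := HasProxies.of_types_eq Φ h1`; the seed floor `m₀ ↦ max m₀ D` (§6 (a)) is a VALUE of the `m₀` field chosen by the choice function of record's twin («…BChoiceDefsVPx»), not a
change of the structure.  Consumers: the GEN closure top «SkelFrmFrom1ChoiceLTKPx» (`drop_of_choiceFnNQLTKPx_at`) and the four GEN column tops.
[cite: KozmaNitzan2024, §4 Theorem 6 (pp. 25–31), pp. 19–21 ((21)–(25))] [cite: BenjaminiSchramm1996, Conj. 4] [this work]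
-/

noncomputable section

open MeasureTheory ProbabilityTheory
open scoped ENNReal Classical

namespace Summit.CriticalPhenomena.PercolationContinuityZ3.Theorems.Transplant

open Literature.Probability.Percolation Literature.Probability.LatticeModels SimpleGraph KNCells KNLevels
open Literature.Barriers.CriticalPhenomena (HasExponentialGrowth)
open SkelConc (Consts)

namespace PlanarSkeletonFrmFrom

/-! ## §1 The uniform-in-`D` variants (first filing; superseded FOR THE NODE by §2's `…PxAt` forms — kept, append-only) -/

/-- **A GEN choice function** (WAVE-Us-MANIFEST §2 (i)): the N2/U choice function `ChoiceFnNQ` over every frames-only skeleton NOT of exponential growth, at a base vertex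
`t ∈ Φ.types` WITH PROXIES at radius `D` (`Φ.HasProxies t D`, in place of the one-type hypothesis `Φ.types = {t}`), every `0 < p < 1` and Φ2 — returning the SAME data
`ChoiceNQ κ Φ t p hC`.  (In the GEN closure it is applied to the REFLECTED skeleton, as `ChoiceFnNQ` is, (R-25); U is the instance `D = 0` by `HasProxies.of_types_eq`.) [this work] -/
def ChoiceFnNQPx : Type 1 :=
  ∀ (κ : Consts) {V : Type} [DecidableEq V] [Countable V] (G : SimpleGraph V) [G.LocallyFinite] (Φ : PlanarSkeletonFrmFrom G),
    ¬ HasExponentialGrowth G → ∀ (t : V), t ∈ Φ.types → ∀ (D : ℕ), Φ.HasProxies t D → ∀ (p : unitInterval), 0 < (p : ℝ) → (p : ℝ) < 1 →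
      ∀ (hC : Φ.CylSubcritical p), ChoiceNQ κ Φ t p hC

/-- **The geometric obligation of a GEN choice function** (`GeomHoldsNQFn` with the binder swap `(h1) ↦ (D) (hP)`; body `ChoiceNQ.GeomHoldsNQ` verbatim). [this work] -/
def GeomHoldsNQFnPx (𝒞₀ : ChoiceFnNQPx) : Prop :=
  ∀ (κ : Consts) {V : Type} [DecidableEq V] [Countable V] (G : SimpleGraph V) [G.LocallyFinite] (Φ : PlanarSkeletonFrmFrom G)
    (hg : ¬ HasExponentialGrowth G) (t : V) (ht : t ∈ Φ.types) (D : ℕ) (hP : Φ.HasProxies t D) (p : unitInterval) (hp0 : 0 < (p : ℝ)) (hp1 : (p : ℝ) < 1)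
    (hC : Φ.CylSubcritical p), (𝒞₀ κ G Φ hg t ht D hP p hp0 hp1 hC).GeomHoldsNQ

/-- **The (R) column Prop under the K-floor for a GEN choice function**: the forward law-carrying root obligation GIVEN the flat root table, asked only for
`Kmin ≤ κ.K₀` (`RootHoldsNQWFnLK` with the binder swap `(h1) ↦ (D) (hP)`; body `ChoiceNQ.RootHoldsNQW` verbatim). [this work] -/
def RootHoldsNQWFnLKPx (Lf : ℕ → ℕ) (Kmin : ℕ) (𝒞₀ : ChoiceFnNQPx) : Prop :=
  ∀ (κ : Consts) {V : Type} [DecidableEq V] [Countable V] (G : SimpleGraph V) [G.LocallyFinite] (Φ : PlanarSkeletonFrmFrom G)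
    (hg : ¬ HasExponentialGrowth G) (t : V) (ht : t ∈ Φ.types) (D : ℕ) (hP : Φ.HasProxies t D) (p : unitInterval) (hp0 : 0 < (p : ℝ)) (hp1 : (p : ℝ) < 1)
    (hC : Φ.CylSubcritical p), Kmin ≤ κ.K₀ → FlatQ Lf κ → (𝒞₀ κ G Φ hg t ht D hP p hp0 hp1 hC).RootHoldsNQW

/-- **The (F) column Prop under the K-floor for a GEN choice function**: the face obligation GIVEN flatness and the face inner-chain fact at target accuracy `dT κ.δ₂`,
asked only for `Kmin ≤ κ.K₀` (`FaceHoldsRNQFnLTK` with the binder swap `(h1) ↦ (D) (hP)`; body `ChoiceNQ.FaceHoldsRNQ` verbatim). [this work] -/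
def FaceHoldsRNQFnLTKPx (Lf : ℕ → ℕ) (dT : ℝ → ℝ) (Kmin : ℕ) (𝒞₀ : ChoiceFnNQPx) : Prop :=
  ∀ (κ : Consts) {V : Type} [DecidableEq V] [Countable V] (G : SimpleGraph V) [G.LocallyFinite] (Φ : PlanarSkeletonFrmFrom G)
    (hg : ¬ HasExponentialGrowth G) (t : V) (ht : t ∈ Φ.types) (D : ℕ) (hP : Φ.HasProxies t D) (p : unitInterval) (hp0 : 0 < (p : ℝ)) (hp1 : (p : ℝ) < 1)
    (hC : Φ.CylSubcritical p), Kmin ≤ κ.K₀ → FlatQ Lf κ → ChainFactQT Lf G Φ.Δ κ (dT κ.δ₂) → (𝒞₀ κ G Φ hg t ht D hP p hp0 hp1 hC).FaceHoldsRNQ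

/-- **The (C) column Prop under the K-floor for a GEN choice function**: the length-budgeted corridor obligation, asked only for `Kmin ≤ κ.K₀` (`ReachHoldsRHNQFnLK`
with the binder swap `(h1) ↦ (D) (hP)`; body `ChoiceNQ.ReachHoldsRHNQL` verbatim). [this work] -/
def ReachHoldsRHNQFnLKPx (Lf : ℕ → ℕ) (Kmin : ℕ) (𝒞₀ : ChoiceFnNQPx) : Prop :=
  ∀ (κ : Consts) {V : Type} [DecidableEq V] [Countable V] (G : SimpleGraph V) [G.LocallyFinite] (Φ : PlanarSkeletonFrmFrom G)
    (hg : ¬ HasExponentialGrowth G) (t : V) (ht : t ∈ Φ.types) (D : ℕ) (hP : Φ.HasProxies t D) (p : unitInterval) (hp0 : 0 < (p : ℝ)) (hp1 : (p : ℝ) < 1)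
    (hC : Φ.CylSubcritical p), Kmin ≤ κ.K₀ → (𝒞₀ κ G Φ hg t ht D hP p hp0 hp1 hC).ReachHoldsRHNQL Lf

/-! ## §2 (appended 2026-08-26, same seat) THE FORMS OF RECORD: the proxy radius `D` as a PARAMETER — `ChoiceFnNQPxAt D` and the four column obligations `…PxAt`

WHY A SECOND SET (append-only; §1's five definitions stay as the uniform-in-`D` variants and are NOT what the node reads): in §1 the radius `D` is bound INSIDE the
choice function (`∀ D, Φ.HasProxies t D → …`), so ONE choice function must serve every radius and its SLOTS cannot depend on `D`; but the choice function of record's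
slot floors DO move with `D` (kit-radius / box floors `… KS.Rs … + D …`, WAVE-Us-MANIFEST §6, §10 C-2/C-4, §11 (e)).  With `D` a PARAMETER (this §2), the U_s node
fixes the one radius `D = D(Φ)` it gets from `hasProxies_coarseFrmFrom` (dictionary part 4) and names the choice function of record AT THAT `D`
(«SkelFrmFromBChoiceDefsVPx»: `frmChoiceAllQ3VPx D slots…`), the GEN column rows keep the U slot binders `(gv fv : Neg.FSlot) …` and their slot-floor hypotheses
verbatim up to `+ D`, and the column tops instantiate the tuple of record at `D`.  Texts: §1's with `(D : ℕ)` moved from the ∀ to the parameters; bodies = the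
𝒞-level U definitions verbatim.  Consumers: the GEN closure top «SkelFrmFrom1ChoiceLTKPx» (`drop_of_choiceFnNQLTKPx_at`) and the four GEN column tops. -/

/-- **A GEN choice function AT PROXY RADIUS `D`** (the form of record; WAVE-Us-MANIFEST §2 (i)): the N2/U choice function `ChoiceFnNQ` over every frames-only skeleton
NOT of exponential growth, at a base vertex `t ∈ Φ.types` WITH PROXIES at radius `D` (`Φ.HasProxies t D` in place of `Φ.types = {t}`), every `0 < p < 1` and Φ2 —
returning the SAME data `ChoiceNQ κ Φ t p hC`; `D` is a parameter of the type, so the slots of a choice function may depend on it.  (Applied to the REFLECTED skeleton in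
the GEN closure, as `ChoiceFnNQ` is, (R-25) — reflections keep `D`, `HasProxies.reflect`; U is the instance `D = 0` by `HasProxies.of_types_eq`.) [this work] -/
def ChoiceFnNQPxAt (D : ℕ) : Type 1 :=
  ∀ (κ : Consts) {V : Type} [DecidableEq V] [Countable V] (G : SimpleGraph V) [G.LocallyFinite] (Φ : PlanarSkeletonFrmFrom G),
    ¬ HasExponentialGrowth G → ∀ (t : V), t ∈ Φ.types → Φ.HasProxies t D → ∀ (p : unitInterval), 0 < (p : ℝ) → (p : ℝ) < 1 →
      ∀ (hC : Φ.CylSubcritical p), ChoiceNQ κ Φ t p hC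

/-- **The geometric obligation of a GEN choice function at radius `D`** (`GeomHoldsNQFn` with the binder swap `(h1) ↦ (hP : Φ.HasProxies t D)`; body
`ChoiceNQ.GeomHoldsNQ` verbatim). [this work] -/
def GeomHoldsNQFnPxAt {D : ℕ} (𝒞₀ : ChoiceFnNQPxAt D) : Prop :=
  ∀ (κ : Consts) {V : Type} [DecidableEq V] [Countable V] (G : SimpleGraph V) [G.LocallyFinite] (Φ : PlanarSkeletonFrmFrom G)
    (hg : ¬ HasExponentialGrowth G) (t : V) (ht : t ∈ Φ.types) (hP : Φ.HasProxies t D) (p : unitInterval) (hp0 : 0 < (p : ℝ)) (hp1 : (p : ℝ) < 1)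
    (hC : Φ.CylSubcritical p), (𝒞₀ κ G Φ hg t ht hP p hp0 hp1 hC).GeomHoldsNQ

/-- **The (R) column Prop under the K-floor for a GEN choice function at radius `D`**: the forward law-carrying root obligation GIVEN the flat root table, asked only
for `Kmin ≤ κ.K₀` (`RootHoldsNQWFnLK` with the binder swap `(h1) ↦ (hP : Φ.HasProxies t D)`; body `ChoiceNQ.RootHoldsNQW` verbatim). [this work] -/
def RootHoldsNQWFnLKPxAt (Lf : ℕ → ℕ) (Kmin : ℕ) {D : ℕ} (𝒞₀ : ChoiceFnNQPxAt D) : Prop :=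
  ∀ (κ : Consts) {V : Type} [DecidableEq V] [Countable V] (G : SimpleGraph V) [G.LocallyFinite] (Φ : PlanarSkeletonFrmFrom G)
    (hg : ¬ HasExponentialGrowth G) (t : V) (ht : t ∈ Φ.types) (hP : Φ.HasProxies t D) (p : unitInterval) (hp0 : 0 < (p : ℝ)) (hp1 : (p : ℝ) < 1)
    (hC : Φ.CylSubcritical p), Kmin ≤ κ.K₀ → FlatQ Lf κ → (𝒞₀ κ G Φ hg t ht hP p hp0 hp1 hC).RootHoldsNQW

/-- **The (F) column Prop under the K-floor for a GEN choice function at radius `D`**: the face obligation GIVEN flatness and the face inner-chain fact at target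
accuracy `dT κ.δ₂`, asked only for `Kmin ≤ κ.K₀` (`FaceHoldsRNQFnLTK` with the binder swap `(h1) ↦ (hP : Φ.HasProxies t D)`; body `ChoiceNQ.FaceHoldsRNQ` verbatim).
[this work] -/
def FaceHoldsRNQFnLTKPxAt (Lf : ℕ → ℕ) (dT : ℝ → ℝ) (Kmin : ℕ) {D : ℕ} (𝒞₀ : ChoiceFnNQPxAt D) : Prop :=
  ∀ (κ : Consts) {V : Type} [DecidableEq V] [Countable V] (G : SimpleGraph V) [G.LocallyFinite] (Φ : PlanarSkeletonFrmFrom G)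
    (hg : ¬ HasExponentialGrowth G) (t : V) (ht : t ∈ Φ.types) (hP : Φ.HasProxies t D) (p : unitInterval) (hp0 : 0 < (p : ℝ)) (hp1 : (p : ℝ) < 1)
    (hC : Φ.CylSubcritical p), Kmin ≤ κ.K₀ → FlatQ Lf κ → ChainFactQT Lf G Φ.Δ κ (dT κ.δ₂) → (𝒞₀ κ G Φ hg t ht hP p hp0 hp1 hC).FaceHoldsRNQ

/-- **The (C) column Prop under the K-floor for a GEN choice function at radius `D`**: the length-budgeted corridor obligation, asked only for `Kmin ≤ κ.K₀`
(`ReachHoldsRHNQFnLK` with the binder swap `(h1) ↦ (hP : Φ.HasProxies t D)`; body `ChoiceNQ.ReachHoldsRHNQL` verbatim). [this work] -/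
def ReachHoldsRHNQFnLKPxAt (Lf : ℕ → ℕ) (Kmin : ℕ) {D : ℕ} (𝒞₀ : ChoiceFnNQPxAt D) : Prop :=
  ∀ (κ : Consts) {V : Type} [DecidableEq V] [Countable V] (G : SimpleGraph V) [G.LocallyFinite] (Φ : PlanarSkeletonFrmFrom G)
    (hg : ¬ HasExponentialGrowth G) (t : V) (ht : t ∈ Φ.types) (hP : Φ.HasProxies t D) (p : unitInterval) (hp0 : 0 < (p : ℝ)) (hp1 : (p : ℝ) < 1)
    (hC : Φ.CylSubcritical p), Kmin ≤ κ.K₀ → (𝒞₀ κ G Φ hg t ht hP p hp0 hp1 hC).ReachHoldsRHNQL Lf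

/-- The uniform-in-`D` choice function of §1 restricts to a choice function at every radius (so §1's form is the special case 'slots independent of `D`'). [folklore] -/
theorem ChoiceFnNQPx.geomHoldsNQFnPxAt_at {𝒞₀ : ChoiceFnNQPx} (h : GeomHoldsNQFnPx 𝒞₀) (D : ℕ) :
    GeomHoldsNQFnPxAt (D := D) (fun κ _ _ _ G _ Φ hg t ht hP p hp0 hp1 hC => 𝒞₀ κ G Φ hg t ht D hP p hp0 hp1 hC) :=
  fun κ _ _ _ G _ Φ hg t ht hP p hp0 hp1 hC => h κ G Φ hg t ht D hP p hp0 hp1 hC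

end PlanarSkeletonFrmFrom

end Summit.CriticalPhenomena.PercolationContinuityZ3.Theorems.Transplant

end
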